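import Literature.Analysis.FluidPDE.NewtonPotentialFarField
import Literature.Analysis.FluidPDE.NormalisedPressureLpBoundProofs
import HarnessLib

/-!
# Far-field expansion of the gradient of the Newtonian potential on `ℝ³` (first and second order)

Analysis/FluidPDE support file (theorems only; no definitions, no named facts). Companion of
`NewtonPotentialFarField.lean` (the monopole expansion `∫ Γ(x − y) F(y) dy = Q Γ(x) + O(|x|⁻²)` of
the Newtonian potential itself). Here the kernel is the GRADIENT of the Newtonian kernel
`Γ(z) = −1/(4π|z|)` of `NewtonKernel.lean`,

  `∂ₐΓ(z) = DΓ(z) a = ⟨z, a⟩/(4π|z|³)`  (`fderiv ℝ newtonKernel z a`),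

and the object is the gradient potential `V_a[F](x) = ∫ ∂ₐΓ(x − y) F(y) dy` of a real density `F`
(for real densities this is the tree's `newtonGradPotential a F x` of `NewtonGradientPotential.lean`,
`•` being multiplication) — the kernel of the Biot–Savart law (`u = Σ ∇Γ ∧ ω`-components), of the
pressure gradient `∇Δ⁻¹∇·f = ∫ ∇Γ(x − y) (∇·f)(y) dy`, and of every dipole field. Lemarié-Rieusset
(2016), §4.10, expands the Biot–Savart velocity of a rapidly decaying vorticity at infinity,

  `u = ∇G ∧ A + Σᵢ ∇∂ᵢG ∧ Bᵢ + Σᵢⱼ ∇∂ᵢ∂ⱼG ∧ Cᵢⱼ + o(|x|⁻⁴)`,  `A = ∫ω`, `Bᵢ = −∫ yᵢ ω`, … (4.37),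

and reads off: `A = 0 ⇒ u = O(|x|⁻³)`; vanishing first moments ⇒ `u = O(|x|⁻⁴)` («zero impulse ⇒
`|x|⁻⁴` tails»). This file proves the KERNEL half of that expansion with explicit remainders, by the
Taylor expansion of `∂ₐΓ(x − y)` in `y` about `0` (Gilbarg–Trudinger (2.12)–(2.14): `|DᵏΓ(z)| ≲ |z|^{−1−k}`):

* `norm_fderiv2_newtonKernel_le` — `‖D²Γ(z)‖ ≤ 1/(π|z|³)`; `norm_fderiv_newtonKernel_sub_sub_le` —
  `‖DΓ(x − y) − DΓ(x)‖ ≤ 8|y|/(π|x|³)` for `|y| ≤ |x|/2`; `exists_norm_fderiv_newtonKernel_taylor_two_le`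
  — `‖DΓ(x − y) − DΓ(x) + D²Γ(x)[y]‖ ≤ M |y|²/|x|⁴` for `|y| ≤ |x|/2` (two mean-value steps,
  `‖D³Γ(z)‖ ≤ M₃/|z|⁴` of `exists_bound_fderiv3_newtonKernel`);
* `integral_indicator_ball_norm_fderiv_newtonKernel` — `∫_{B(x,r)} ‖DΓ(x − y)‖ dy = 3|B₁| r/(4π)`;
* `integrable_fderiv_newtonKernel_sub_mul`, `abs_integral_fderiv_newtonKernel_sub_mul_le` — the
  integrand `∂ₐΓ(x − y) F(y)` is integrable and `|V_a[F](x)| ≤ ‖a‖ (3|B₁| C₀/(4π) + ‖F‖₁/(4π))` as soon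
  as `F ∈ L¹` and `|F| ≤ C₀` on `B(x, 1)`;
* `exists_abs_integral_fderiv_newtonKernel_sub_monopole_le` — **FIRST ORDER**: for `F ∈ L¹` with
  `∫‖y‖|F| < ∞` and `‖y‖⁴|F(y)| ≤ C₄`, and `‖x‖ ≥ 4`,
  `|V_a[F](x) − (∫F) ∂ₐΓ(x)| ≤ K (∫‖y‖|F| + C₄) ‖a‖ ‖x‖⁻³`;
* `exists_abs_integral_fderiv_newtonKernel_sub_dipole_le` — **SECOND ORDER**: for `F ∈ L¹` with
  `∫‖y‖²|F| < ∞` and `‖y‖⁵|F(y)| ≤ C₅`, and `‖x‖ ≥ 4`,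
  `|V_a[F](x) − (∫F) ∂ₐΓ(x) + D²Γ(x)[∫ y F(y) dy, a]| ≤ K (∫‖y‖²|F| + C₅) ‖a‖ ‖x‖⁻⁴`;
* corollaries `…_of_integral_eq_zero` (`∫F = 0 ⇒ O(‖x‖⁻³)`; `∫F = 0 ∧ ∫ yF = 0 ⇒ O(‖x‖⁻⁴)`) and the
  global weighted forms `exists_forall_one_add_norm_pow_three_mul_abs_integral_le` /
  `exists_forall_one_add_norm_pow_four_mul_abs_integral_le`
  (`(1 + ‖x‖)ᵏ |V_a[F](x)| ≤ K′ (C₀ + ‖F‖₁ + moment + Cₖ₊₁) ‖a‖` for all `x`, `k = 3, 4`).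

Cell `ns-blowup` label: LABEL Literature port (potential theory); bears_on LADDER-NS N1
(route-NavierStokesRegularity-PalasekTowerBreakdown, crux 19249 negative lane `CapStratumIntegrable`
— the «zero impulse ⇒ O(|x|⁻⁴) tails» input — and the §3 whole-space-decay row of the harvest map:
the far field of the pressure gradient `∇Δ⁻¹∇·f` of a mean-zero force). WHAT THIS IS NOT: not NS —
estimates for a fixed kernel against a fixed density; nothing is asserted about any solution.

## Mathlib / tree search

Tree (all used): `newtonKernel`, `contDiffAt_newtonKernel`, `contDiffOn_fderiv_newtonKernel`,
`contDiffOn_fderiv2_newtonKernel`, `norm_fderiv_newtonKernel`, `abs_fderiv_fderiv_newtonKernel_apply_le`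
(`NewtonKernel`); `exists_bound_fderiv3_newtonKernel` (`NormalisedPressureLpBoundProofs`);
`half_norm_le_of_mem_closedBall` (`NewtonPotentialFarField`, the zeroth-order template followed here);
`NewtonPotentialHolder.integral_ball_norm_rpow_neg` / `integrableOn_ball_norm_rpow_neg`;
`measurable_newtonKernel` (`NewtonPotential`). `lean search`/`rg 'impulse|moment' NewtonPotential*
BiotSavart*`: no far-field expansion beyond order zero existed. Mathlib:
`Convex.norm_image_sub_le_of_norm_hasFDerivWithin_le` (mean value inequality),
`ContinuousLinearMap.integral_comp_comm`, `ContinuousLinearMap.opNorm_le_bound`,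
`measurable_fderiv_apply_const`.

## References

* P. G. Lemarié-Rieusset, *The Navier–Stokes Problem in the 21st Century*, CRC Press 2016, §4.10,
  eq. (4.37) and the paragraph following it (p. 63; §4.9 Thm. 4.11 (4.34) for the velocity with force).
  [LemarieRieusset2016]
* D. Gilbarg, N. S. Trudinger, *Elliptic Partial Differential Equations of Second Order* (2001),
  (2.12)–(2.14) (the Newtonian kernel and the bounds on its derivatives). [GilbargTrudinger2001]
-/

noncomputable section

set_option maxSynthPendingDepth 3

open MeasureTheory Set Filter Metric Topology Function Real
open scoped RealInnerProductSpace

namespace Literature.Analysis.FluidPDE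

/-! ### Derivative bounds and Taylor increments of `DΓ` far from the pole -/

section Kernel

/-- Points of the closed ball `B̄(x, ‖x‖/2)` about `x ≠ 0` are not the origin. [folklore] -/
private theorem ne_zero_of_mem_closedBall_half {x z : EuclideanSpace ℝ (Fin 3)} (hx : x ≠ 0)
    (hz : z ∈ closedBall x (‖x‖ / 2)) : z ≠ 0 := by
  intro h0
  have h := half_norm_le_of_mem_closedBall hz
  rw [h0, norm_zero] at h
  have hx0 : 0 < ‖x‖ := norm_pos_iff.2 hx
  linarith

/-- `x − w ∈ B̄(x, ‖x‖/2)` when `‖w‖ ≤ ‖x‖/2`. [folklore] -/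
private theorem sub_mem_closedBall_half {x w : EuclideanSpace ℝ (Fin 3)} (hw : ‖w‖ ≤ ‖x‖ / 2) :
    x - w ∈ closedBall x (‖x‖ / 2) := by
  rw [mem_closedBall, dist_eq_norm, sub_sub_cancel_left, norm_neg]
  exact hw

/-- `DΓ` is differentiable off the origin. [folklore] -/
private theorem differentiableAt_fderiv_newtonKernel {z : EuclideanSpace ℝ (Fin 3)} (hz : z ≠ 0) :
    DifferentiableAt ℝ (fderiv ℝ newtonKernel) z :=
  ((contDiffOn_fderiv_newtonKernel (n := 1)).differentiableOn one_ne_zero).differentiableAt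
    (isOpen_compl_singleton.mem_nhds hz)

/-- `D²Γ` is differentiable off the origin. [folklore] -/
private theorem differentiableAt_fderiv2_newtonKernel {z : EuclideanSpace ℝ (Fin 3)} (hz : z ≠ 0) :
    DifferentiableAt ℝ (fderiv ℝ (fderiv ℝ newtonKernel)) z :=
  ((contDiffOn_fderiv2_newtonKernel (n := 1)).differentiableOn one_ne_zero).differentiableAt
    (isOpen_compl_singleton.mem_nhds hz)

/-- **`‖D²Γ(z)‖ ≤ 1/(π|z|³)`** for `z ≠ 0` (operator norm; from the entrywise bound
`|D²Γ(z)(a, b)| ≤ |a||b|/(π|z|³)`, Gilbarg–Trudinger (2.13)). [cite: GilbargTrudinger2001, (2.13)–(2.14)] -/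
theorem norm_fderiv2_newtonKernel_le {z : EuclideanSpace ℝ (Fin 3)} (hz : z ≠ 0) :
    ‖fderiv ℝ (fderiv ℝ newtonKernel) z‖ ≤ 1 / (π * ‖z‖ ^ 3) := by
  have hz0 : 0 < ‖z‖ := norm_pos_iff.2 hz
  have h0 : 0 ≤ 1 / (π * ‖z‖ ^ 3) := by positivity
  refine ContinuousLinearMap.opNorm_le_bound _ h0 fun b => ?_
  refine ContinuousLinearMap.opNorm_le_bound _ (by positivity) fun a => ?_
  -- `D²Γ(z) b a = ∂_b(∂ₐΓ)(z)`
  have hid : fderiv ℝ (fderiv ℝ newtonKernel) z b a = fderiv ℝ (fun w => fderiv ℝ newtonKernel w a) z b := by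
    rw [fderiv_clm_apply (differentiableAt_fderiv_newtonKernel hz) (differentiableAt_const a)]
    simp
  rw [Real.norm_eq_abs, hid]
  calc |fderiv ℝ (fun w => fderiv ℝ newtonKernel w a) z b| ≤ ‖a‖ * ‖b‖ / (π * ‖z‖ ^ 3) :=
        abs_fderiv_fderiv_newtonKernel_apply_le hz a b
    _ = 1 / (π * ‖z‖ ^ 3) * ‖b‖ * ‖a‖ := by ring

/-- **First-order increment of `DΓ` far from the pole**: for `x ≠ 0` and `‖y‖ ≤ ‖x‖/2`,
`‖DΓ(x − y) − DΓ(x)‖ ≤ 8‖y‖/(π‖x‖³)` (mean value inequality on the convex ball `B̄(x, ‖x‖/2)`, where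
`‖z‖ ≥ ‖x‖/2` and so `‖D²Γ(z)‖ ≤ 8/(π‖x‖³)`). [cite: GilbargTrudinger2001, (2.13)–(2.14)] -/
theorem norm_fderiv_newtonKernel_sub_sub_le {x y : EuclideanSpace ℝ (Fin 3)} (hx : x ≠ 0)
    (hy : ‖y‖ ≤ ‖x‖ / 2) :
    ‖fderiv ℝ newtonKernel (x - y) - fderiv ℝ newtonKernel x‖ ≤ 8 * ‖y‖ / (π * ‖x‖ ^ 3) := by
  have hx0 : 0 < ‖x‖ := norm_pos_iff.2 hx
  have hdiff : ∀ z ∈ closedBall x (‖x‖ / 2), DifferentiableAt ℝ (fderiv ℝ newtonKernel) z :=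
    fun z hz => differentiableAt_fderiv_newtonKernel (ne_zero_of_mem_closedBall_half hx hz)
  have hbound : ∀ z ∈ closedBall x (‖x‖ / 2),
      ‖fderiv ℝ (fderiv ℝ newtonKernel) z‖ ≤ 8 / (π * ‖x‖ ^ 3) := by
    intro z hz
    have hz0 := ne_zero_of_mem_closedBall_half hx hz
    have hz' := half_norm_le_of_mem_closedBall hz
    have hzpos : 0 < ‖z‖ := norm_pos_iff.2 hz0
    refine (norm_fderiv2_newtonKernel_le hz0).trans ?_
    rw [div_le_div_iff₀ (by positivity) (by positivity), one_mul]
    have h3 : (‖x‖ / 2) ^ 3 ≤ ‖z‖ ^ 3 := pow_le_pow_left₀ (by positivity) hz' 3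
    nlinarith [h3, pi_pos, pow_pos hx0 3]
  have h := (convex_closedBall x (‖x‖ / 2)).norm_image_sub_le_of_norm_fderiv_le hdiff hbound
    (mem_closedBall_self (by positivity)) (sub_mem_closedBall_half hy)
  rw [sub_sub_cancel_left, norm_neg] at h
  calc ‖fderiv ℝ newtonKernel (x - y) - fderiv ℝ newtonKernel x‖ ≤ 8 / (π * ‖x‖ ^ 3) * ‖y‖ := h
    _ = 8 * ‖y‖ / (π * ‖x‖ ^ 3) := by ring

/-- **First-order increment of `D²Γ` far from the pole**: with `‖D³Γ(z)‖ ≤ M₃/|z|⁴` off the origin,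
for `x ≠ 0` and `‖w‖ ≤ ‖x‖/2`, `‖D²Γ(x − w) − D²Γ(x)‖ ≤ 16 M₃ ‖w‖/‖x‖⁴`. [cite: GilbargTrudinger2001, (2.13)–(2.14)] -/
theorem norm_fderiv2_newtonKernel_sub_sub_le {M₃ : ℝ} (hM₃0 : 0 ≤ M₃)
    (hM₃ : ∀ z : EuclideanSpace ℝ (Fin 3), z ≠ 0 →
      ‖fderiv ℝ (fderiv ℝ (fderiv ℝ newtonKernel)) z‖ ≤ M₃ / ‖z‖ ^ 4)
    {x w : EuclideanSpace ℝ (Fin 3)} (hx : x ≠ 0) (hw : ‖w‖ ≤ ‖x‖ / 2) :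
    ‖fderiv ℝ (fderiv ℝ newtonKernel) (x - w) - fderiv ℝ (fderiv ℝ newtonKernel) x‖ ≤
      16 * M₃ * ‖w‖ / ‖x‖ ^ 4 := by
  have hx0 : 0 < ‖x‖ := norm_pos_iff.2 hx
  have hdiff : ∀ z ∈ closedBall x (‖x‖ / 2),
      DifferentiableAt ℝ (fderiv ℝ (fderiv ℝ newtonKernel)) z :=
    fun z hz => differentiableAt_fderiv2_newtonKernel (ne_zero_of_mem_closedBall_half hx hz)
  have hbound : ∀ z ∈ closedBall x (‖x‖ / 2),
      ‖fderiv ℝ (fderiv ℝ (fderiv ℝ newtonKernel)) z‖ ≤ 16 * M₃ / ‖x‖ ^ 4 := by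
    intro z hz
    have hz0 := ne_zero_of_mem_closedBall_half hx hz
    have hz' := half_norm_le_of_mem_closedBall hz
    have hzpos : 0 < ‖z‖ := norm_pos_iff.2 hz0
    refine (hM₃ z hz0).trans ?_
    rw [div_le_div_iff₀ (by positivity) (by positivity)]
    have h4 : (‖x‖ / 2) ^ 4 ≤ ‖z‖ ^ 4 := pow_le_pow_left₀ (by positivity) hz' 4
    nlinarith [h4, pow_pos hx0 4]
  have h := (convex_closedBall x (‖x‖ / 2)).norm_image_sub_le_of_norm_fderiv_le hdiff hbound
    (mem_closedBall_self (by positivity)) (sub_mem_closedBall_half hw)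
  rw [sub_sub_cancel_left, norm_neg] at h
  calc ‖fderiv ℝ (fderiv ℝ newtonKernel) (x - w) - fderiv ℝ (fderiv ℝ newtonKernel) x‖
      ≤ 16 * M₃ / ‖x‖ ^ 4 * ‖w‖ := h
    _ = 16 * M₃ * ‖w‖ / ‖x‖ ^ 4 := by ring

/-- **Second-order Taylor increment of `DΓ` far from the pole**: there is `M ≥ 0` such that for
all `x ≠ 0` and `‖y‖ ≤ ‖x‖/2`,
`‖DΓ(x − y) − DΓ(x) + D²Γ(x)[y]‖ ≤ M ‖y‖²/‖x‖⁴` (mean value inequality for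
`ψ(w) = DΓ(x − w) − DΓ(x) + D²Γ(x)[w]` on `B̄(0, ‖y‖)`, whose derivative `D²Γ(x) − D²Γ(x − w)` is
bounded by `16 M₃ ‖w‖/‖x‖⁴` by `norm_fderiv2_newtonKernel_sub_sub_le`; `M = 16 M₃`).
[cite: GilbargTrudinger2001, (2.13)–(2.14)] -/
theorem exists_norm_fderiv_newtonKernel_taylor_two_le :
    ∃ M : ℝ, 0 ≤ M ∧ ∀ {x y : EuclideanSpace ℝ (Fin 3)}, x ≠ 0 → ‖y‖ ≤ ‖x‖ / 2 →
      ‖fderiv ℝ newtonKernel (x - y) - fderiv ℝ newtonKernel x + fderiv ℝ (fderiv ℝ newtonKernel) x y‖ ≤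
        M * ‖y‖ ^ 2 / ‖x‖ ^ 4 := by
  obtain ⟨M₃, hM₃0, hM₃⟩ := exists_bound_fderiv3_newtonKernel
  refine ⟨16 * M₃, by positivity, fun {x y} hx hy => ?_⟩
  have hx0 : 0 < ‖x‖ := norm_pos_iff.2 hx
  set G₁ : EuclideanSpace ℝ (Fin 3) → EuclideanSpace ℝ (Fin 3) →L[ℝ] ℝ := fderiv ℝ newtonKernel with hG₁
  set G₂ : EuclideanSpace ℝ (Fin 3) → EuclideanSpace ℝ (Fin 3) →L[ℝ] EuclideanSpace ℝ (Fin 3) →L[ℝ] ℝ :=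
    fderiv ℝ (fderiv ℝ newtonKernel) with hG₂
  set ψ : EuclideanSpace ℝ (Fin 3) → EuclideanSpace ℝ (Fin 3) →L[ℝ] ℝ :=
    fun w => G₁ (x - w) - G₁ x + G₂ x w with hψ
  -- the derivative of `ψ` on the ball `B̄(0, ‖y‖)`
  have hderiv : ∀ w ∈ closedBall (0 : EuclideanSpace ℝ (Fin 3)) ‖y‖,
      HasFDerivWithinAt ψ (G₂ x - G₂ (x - w)) (closedBall 0 ‖y‖) w := by
    intro w hw
    have hw' : ‖w‖ ≤ ‖x‖ / 2 := by
      rw [mem_closedBall, dist_zero_right] at hw; exact hw.trans hy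
    have hxw : x - w ≠ 0 := ne_zero_of_mem_closedBall_half hx (sub_mem_closedBall_half hw')
    have h1 : HasFDerivAt G₁ (G₂ (x - w)) (x - w) := by
      rw [hG₂]; exact (differentiableAt_fderiv_newtonKernel hxw).hasFDerivAt
    have h2 : HasFDerivAt (fun w => G₁ (x - w))
        ((G₂ (x - w)).comp (-(ContinuousLinearMap.id ℝ (EuclideanSpace ℝ (Fin 3))))) w := by
      have hs : HasFDerivAt (fun w : EuclideanSpace ℝ (Fin 3) => x - w)
          (-(ContinuousLinearMap.id ℝ (EuclideanSpace ℝ (Fin 3)))) w :=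
        (hasFDerivAt_id w).const_sub x
      exact h1.comp w hs
    have h2' : HasFDerivAt (fun w => G₁ (x - w)) (-(G₂ (x - w))) w := by
      have he : (G₂ (x - w)).comp (-(ContinuousLinearMap.id ℝ (EuclideanSpace ℝ (Fin 3)))) = -(G₂ (x - w)) := by
        rw [ContinuousLinearMap.comp_neg, ContinuousLinearMap.comp_id]
      rw [← he]; exact h2
    have h3 : HasFDerivAt (fun w => G₂ x w) (G₂ x) w := (G₂ x).hasFDerivAt
    have h4 : HasFDerivAt ψ (-(G₂ (x - w)) - 0 + G₂ x) w :=
      (h2'.sub (hasFDerivAt_const (G₁ x) w)).add h3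
    have he2 : -(G₂ (x - w)) - 0 + G₂ x = G₂ x - G₂ (x - w) := by abel
    rw [he2] at h4
    exact h4.hasFDerivWithinAt
  have hbound : ∀ w ∈ closedBall (0 : EuclideanSpace ℝ (Fin 3)) ‖y‖,
      ‖G₂ x - G₂ (x - w)‖ ≤ 16 * M₃ * ‖y‖ / ‖x‖ ^ 4 := by
    intro w hw
    rw [mem_closedBall, dist_zero_right] at hw
    have hw' : ‖w‖ ≤ ‖x‖ / 2 := hw.trans hy
    rw [norm_sub_rev]
    refine (norm_fderiv2_newtonKernel_sub_sub_le hM₃0 hM₃ hx hw').trans ?_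
    exact div_le_div_of_nonneg_right (by nlinarith) (by positivity)
  have h := (convex_closedBall (0 : EuclideanSpace ℝ (Fin 3)) ‖y‖).norm_image_sub_le_of_norm_hasFDerivWithin_le
    hderiv hbound (mem_closedBall_self (norm_nonneg y)) (mem_closedBall.2 (by rw [dist_zero_right]))
  have hψ0 : ψ 0 = 0 := by simp [hψ]
  rw [hψ0, sub_zero, sub_zero] at h
  calc ‖G₁ (x - y) - G₁ x + G₂ x y‖ = ‖ψ y‖ := rfl
    _ ≤ 16 * M₃ * ‖y‖ / ‖x‖ ^ 4 * ‖y‖ := h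
    _ = 16 * M₃ * ‖y‖ ^ 2 / ‖x‖ ^ 4 := by ring

end Kernel

/-! ### The ball integral of `‖DΓ‖` and integrability of the gradient-potential integrand -/

section Integrability

/-- Integrability of `y ↦ 1_{B(x, r)}(y) ‖DΓ(x − y)‖` and the value of its integral:
`∫_{B(x,r)} ‖DΓ(x − y)‖ dy = 3|B₁| r/(4π)` (`‖DΓ(z)‖ = (4π|z|²)⁻¹` off the origin, translation, and
the radial integral `∫_{B(0,r)} |z|⁻² dz = 3|B₁| r`; Gilbarg–Trudinger (2.14) `|DΓ(z)| ≤ |z|^{1-n}/(n ωₙ)`).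
[cite: GilbargTrudinger2001, (2.12)–(2.14)] -/
theorem integral_indicator_ball_norm_fderiv_newtonKernel (x : EuclideanSpace ℝ (Fin 3)) {r : ℝ}
    (hr : 0 < r) :
    Integrable (fun y ↦ (ball x r).indicator (fun y ↦ ‖fderiv ℝ newtonKernel (x - y)‖) y) volume ∧
    ∫ y, (ball x r).indicator (fun y ↦ ‖fderiv ℝ newtonKernel (x - y)‖) y =
      3 * (volume : Measure (EuclideanSpace ℝ (Fin 3))).real (ball 0 1) * r / (4 * π) := by
  -- `1_{B(x,r)}(y) ‖DΓ(x - y)‖ = G(x - y)` with `G = 1_{B(0,r)} ‖DΓ‖`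
  have hG : ∀ y, (ball x r).indicator (fun y ↦ ‖fderiv ℝ newtonKernel (x - y)‖) y =
      (ball (0 : EuclideanSpace ℝ (Fin 3)) r).indicator (fun z ↦ ‖fderiv ℝ newtonKernel z‖) (x - y) := by
    intro y
    by_cases hy : y ∈ ball x r
    · have : x - y ∈ ball (0 : EuclideanSpace ℝ (Fin 3)) r := by
        rw [mem_ball_zero_iff, norm_sub_rev]; rwa [mem_ball, dist_eq_norm] at hy
      rw [indicator_of_mem hy, indicator_of_mem this]
    · have : x - y ∉ ball (0 : EuclideanSpace ℝ (Fin 3)) r := fun h ↦ hy (by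
        rw [mem_ball, dist_eq_norm, ← norm_sub_rev]; rwa [mem_ball_zero_iff] at h)
      rw [indicator_of_notMem hy, indicator_of_notMem this]
  -- off the origin (a null set) `‖DΓ(z)‖ = (4π)⁻¹ |z|⁻²`
  have hae : (fun z : EuclideanSpace ℝ (Fin 3) ↦ (4 * π)⁻¹ * ‖z‖ ^ (-(2 : ℝ))) =ᵐ[volume.restrict (ball 0 r)]
      fun z ↦ ‖fderiv ℝ newtonKernel z‖ := by
    have h0 : ∀ᵐ z ∂(volume : Measure (EuclideanSpace ℝ (Fin 3))), z ≠ 0 := by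
      rw [ae_iff]
      simp only [ne_eq, not_not, setOf_eq_eq_singleton, measure_singleton]
    filter_upwards [ae_restrict_of_ae h0] with z hz
    rw [norm_fderiv_newtonKernel hz, Real.rpow_neg (norm_nonneg _),
      show (2 : ℝ) = ((2 : ℕ) : ℝ) by norm_num, Real.rpow_natCast, ← mul_inv]
  have hint0 : IntegrableOn (fun z : EuclideanSpace ℝ (Fin 3) ↦ ‖fderiv ℝ newtonKernel z‖) (ball 0 r) volume := by
    have h1 : IntegrableOn (fun z : EuclideanSpace ℝ (Fin 3) ↦ (4 * π)⁻¹ * ‖z‖ ^ (-(2 : ℝ))) (ball 0 r) volume :=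
      (NewtonPotentialHolder.integrableOn_ball_norm_rpow_neg (s := 2) (by norm_num) r).const_mul
        (4 * π)⁻¹
    exact h1.congr hae
  have hintG : Integrable (fun z : EuclideanSpace ℝ (Fin 3) ↦
      (ball (0 : EuclideanSpace ℝ (Fin 3)) r).indicator (fun z ↦ ‖fderiv ℝ newtonKernel z‖) z) :=
    (integrable_indicator_iff measurableSet_ball).2 hint0
  refine ⟨?_, ?_⟩
  · simp_rw [hG]
    exact hintG.comp_sub_left x
  · simp_rw [hG]
    rw [integral_sub_left_eq_self (fun z ↦ (ball (0 : EuclideanSpace ℝ (Fin 3)) r).indicator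
      (fun z ↦ ‖fderiv ℝ newtonKernel z‖) z) volume x, integral_indicator measurableSet_ball,
      ← integral_congr_ae hae, integral_const_mul,
      NewtonPotentialHolder.integral_ball_norm_rpow_neg (by norm_num) hr]
    norm_num
    ring

/-- **Integrability and the crude bound of the gradient-potential integrand.** If `F ∈ L¹(ℝ³)` and
`|F| ≤ C₀` on the unit ball about `x`, then `y ↦ ∂ₐΓ(x − y) F(y)` is integrable and
`|∫ ∂ₐΓ(x − y) F(y) dy| ≤ ‖a‖ (3|B₁| C₀/(4π) + (4π)⁻¹ ‖F‖₁)`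
(`|∂ₐΓ(x − y) F(y)| ≤ ‖a‖ (C₀ 1_{B(x,1)}(y)‖DΓ(x − y)‖ + (4π)⁻¹ |F(y)|)`, as `‖DΓ(z)‖ ≤ (4π)⁻¹`
for `|z| ≥ 1`). [cite: GilbargTrudinger2001, (2.12)–(2.14)] -/
theorem integrable_fderiv_newtonKernel_sub_mul {F : EuclideanSpace ℝ (Fin 3) → ℝ}
    (hFi : Integrable F volume) {x : EuclideanSpace ℝ (Fin 3)} {C₀ : ℝ}
    (hC₀ : ∀ y ∈ ball x 1, |F y| ≤ C₀) (a : EuclideanSpace ℝ (Fin 3)) :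
    Integrable (fun y ↦ fderiv ℝ newtonKernel (x - y) a * F y) volume ∧
    |∫ y, fderiv ℝ newtonKernel (x - y) a * F y| ≤
      ‖a‖ * (3 * (volume : Measure (EuclideanSpace ℝ (Fin 3))).real (ball 0 1) * C₀ / (4 * π) +
        (4 * π)⁻¹ * ∫ y, |F y|) := by
  have hC0 : 0 ≤ C₀ := (abs_nonneg _).trans (hC₀ x (mem_ball_self one_pos))
  obtain ⟨hI1, hI1v⟩ := integral_indicator_ball_norm_fderiv_newtonKernel x one_pos
  -- the majorant
  set g : EuclideanSpace ℝ (Fin 3) → ℝ := fun y ↦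
    ‖a‖ * (C₀ * (ball x 1).indicator (fun y ↦ ‖fderiv ℝ newtonKernel (x - y)‖) y + (4 * π)⁻¹ * |F y|)
    with hg
  have hgi : Integrable g volume := ((hI1.const_mul C₀).add (hFi.abs.const_mul _)).const_mul ‖a‖
  have hmeas : AEStronglyMeasurable (fun y ↦ fderiv ℝ newtonKernel (x - y) a * F y) volume :=
    ((measurable_fderiv_apply_const ℝ newtonKernel a).comp
      (measurable_const.sub measurable_id)).aestronglyMeasurable.mul hFi.1
  have hptw : ∀ y, ‖fderiv ℝ newtonKernel (x - y) a * F y‖ ≤ g y := by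
    intro y
    rw [norm_mul, Real.norm_eq_abs, Real.norm_eq_abs]
    simp only [hg]
    have hK : |fderiv ℝ newtonKernel (x - y) a| ≤ ‖fderiv ℝ newtonKernel (x - y)‖ * ‖a‖ := by
      rw [← Real.norm_eq_abs]; exact ContinuousLinearMap.le_opNorm _ _
    have hind0 : 0 ≤ (ball x 1).indicator (fun y ↦ ‖fderiv ℝ newtonKernel (x - y)‖) y :=
      Set.indicator_nonneg (fun _ _ ↦ norm_nonneg _) _
    by_cases hy : y ∈ ball x 1
    · rw [indicator_of_mem hy]
      have hFy : |F y| ≤ C₀ := hC₀ y hy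
      calc |fderiv ℝ newtonKernel (x - y) a| * |F y|
          ≤ ‖fderiv ℝ newtonKernel (x - y)‖ * ‖a‖ * C₀ :=
            mul_le_mul hK hFy (abs_nonneg _) (by positivity)
        _ = ‖a‖ * (C₀ * ‖fderiv ℝ newtonKernel (x - y)‖) := by ring
        _ ≤ ‖a‖ * (C₀ * ‖fderiv ℝ newtonKernel (x - y)‖ + (4 * π)⁻¹ * |F y|) := by
            gcongr; exact le_add_of_nonneg_right (by positivity)
    · rw [indicator_of_notMem hy, mul_zero, zero_add]
      have hxy : 1 ≤ ‖x - y‖ := by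
        rw [mem_ball, dist_eq_norm, not_lt, norm_sub_rev] at hy; exact hy
      have hxy0 : x - y ≠ 0 := norm_pos_iff.1 (lt_of_lt_of_le one_pos hxy)
      have hΓ : ‖fderiv ℝ newtonKernel (x - y)‖ ≤ (4 * π)⁻¹ := by
        rw [norm_fderiv_newtonKernel hxy0]
        have h2 : (1 : ℝ) ≤ ‖x - y‖ ^ 2 := one_le_pow₀ hxy
        exact inv_anti₀ (by positivity) (by nlinarith [pi_pos])
      calc |fderiv ℝ newtonKernel (x - y) a| * |F y| ≤ (4 * π)⁻¹ * ‖a‖ * |F y| := by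
            refine mul_le_mul_of_nonneg_right (hK.trans ?_) (abs_nonneg _)
            exact mul_le_mul_of_nonneg_right hΓ (norm_nonneg _)
        _ = ‖a‖ * ((4 * π)⁻¹ * |F y|) := by ring
  have hint : Integrable (fun y ↦ fderiv ℝ newtonKernel (x - y) a * F y) volume :=
    hgi.mono' hmeas (Eventually.of_forall hptw)
  refine ⟨hint, ?_⟩
  have hle := norm_integral_le_of_norm_le hgi (Eventually.of_forall hptw)
  rw [Real.norm_eq_abs] at hle
  refine hle.trans (le_of_eq ?_)
  rw [hg, integral_const_mul, integral_add (hI1.const_mul C₀) (hFi.abs.const_mul _), integral_const_mul,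
    integral_const_mul, hI1v]
  ring

/-- **The dipole term is linear in the first moment**: if `y ↦ F(y) y` is integrable then
`∫ D²Γ(x)[y, a] F(y) dy = D²Γ(x)[∫ F(y) y dy, a]` (a continuous linear functional commutes with the
Bochner integral) — the dipole coefficients `Bᵢ = −∫ yᵢ ω` of Lemarié-Rieusset's (4.37).
[cite: LemarieRieusset2016, §4.10 eq. (4.37) (p. 63)] -/
theorem integral_fderiv2_newtonKernel_apply_mul {F : EuclideanSpace ℝ (Fin 3) → ℝ}
    (hM : Integrable (fun y ↦ F y • y) volume) (x a : EuclideanSpace ℝ (Fin 3)) :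
    ∫ y, fderiv ℝ (fderiv ℝ newtonKernel) x y a * F y =
      fderiv ℝ (fderiv ℝ newtonKernel) x (∫ y, F y • y) a := by
  set L : EuclideanSpace ℝ (Fin 3) →L[ℝ] ℝ := (fderiv ℝ (fderiv ℝ newtonKernel) x).flip a with hL
  have hLy : ∀ y, L y = fderiv ℝ (fderiv ℝ newtonKernel) x y a := fun y ↦ by
    rw [hL, ContinuousLinearMap.flip_apply]
  have h1 : (fun y ↦ fderiv ℝ (fderiv ℝ newtonKernel) x y a * F y) = fun y ↦ L (F y • y) := by
    funext y
    rw [map_smul, smul_eq_mul, hLy, mul_comm]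
  rw [h1, ContinuousLinearMap.integral_comp_comm L hM, hLy]

/-- The first absolute moment is finite when the zeroth and the second are. [folklore] -/
private theorem integrable_norm_mul_of_sq {F : EuclideanSpace ℝ (Fin 3) → ℝ} (hFi : Integrable F volume)
    (hM2 : Integrable (fun y ↦ ‖y‖ ^ 2 * F y) volume) :
    Integrable (fun y ↦ ‖y‖ * F y) volume := by
  have hmaj : Integrable (fun y ↦ |F y| + ‖y‖ ^ 2 * |F y|) volume := by
    refine hFi.abs.add (hM2.abs.congr (Eventually.of_forall fun y ↦ ?_))
    simp only [abs_mul, abs_pow, abs_norm]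
  refine hmaj.mono' ((continuous_norm.measurable.aestronglyMeasurable).mul hFi.1)
    (Eventually.of_forall fun y ↦ ?_)
  rw [Real.norm_eq_abs, abs_mul, abs_norm]
  have h1 : ‖y‖ ≤ 1 + ‖y‖ ^ 2 := by nlinarith [norm_nonneg y, sq_nonneg (‖y‖ - 1)]
  nlinarith [abs_nonneg (F y), h1]

/-- The vector first moment `y ↦ F(y) y` is integrable when `∫ ‖y‖ |F| < ∞`. [folklore] -/
private theorem integrable_smul_self_of_norm_mul {F : EuclideanSpace ℝ (Fin 3) → ℝ} (hFi : Integrable F volume)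
    (hM1 : Integrable (fun y ↦ ‖y‖ * F y) volume) :
    Integrable (fun y ↦ F y • y) volume := by
  refine hM1.norm.mono' (hFi.1.smul measurable_id.aestronglyMeasurable) (Eventually.of_forall fun y ↦ ?_)
  rw [norm_smul, norm_mul, Real.norm_eq_abs, Real.norm_eq_abs, abs_norm, mul_comm]

end Integrability

/-! ### The far-field expansion of the gradient potential, first order -/

section FirstOrder

/-- Quartic (or quintic) decay makes `F` bounded by its decay constant on the unit ball about a far
point: if `‖y‖ᵏ |F(y)| ≤ C` for all `y` and `‖x‖ ≥ 4`, then `|F| ≤ C` on `B(x, 1)` (there `‖y‖ ≥ 3`).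
[folklore] -/
private theorem abs_le_of_pow_mul_abs_le_of_mem_ball {F : EuclideanSpace ℝ (Fin 3) → ℝ} {k : ℕ} {C : ℝ}
    (hC : ∀ y, ‖y‖ ^ k * |F y| ≤ C) {x : EuclideanSpace ℝ (Fin 3)} (hx : 4 ≤ ‖x‖) :
    ∀ y ∈ ball x 1, |F y| ≤ C := by
  intro y hy
  have hy3 : 3 ≤ ‖y‖ := by
    rw [mem_ball, dist_eq_norm] at hy
    have := norm_sub_norm_le x y
    have h' : ‖x - y‖ = ‖y - x‖ := norm_sub_rev x y
    linarith
  have h1 : 1 ≤ ‖y‖ ^ k := one_le_pow₀ (by linarith)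
  have := hC y
  nlinarith [abs_nonneg (F y)]

/-- **Far-field expansion of the gradient of the Newtonian potential, first order (monopole term).**
Let `F : ℝ³ → ℝ` be integrable with `∫ ‖y‖ |F(y)| dy < ∞` and `‖y‖⁴ |F(y)| ≤ C₄`. Then for
`‖x‖ ≥ 4` and every direction `a` the gradient potential `V_a(x) = ∫ ∂ₐΓ(x − y) F(y) dy` satisfies

  `|V_a(x) − Q ∂ₐΓ(x)| ≤ ((17/(2π)) ∫‖y‖|F| + (3|B₁|/π) C₄) ‖a‖ ‖x‖⁻³`,  `Q = ∫ F`

— i.e. `∇(Γ ⋆ F)(x) = Q ∇Γ(x) + O(|x|⁻³)` (near region `‖y‖ ≤ ‖x‖/2`: the increment bound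
`‖DΓ(x − y) − DΓ(x)‖ ≤ 8‖y‖/(π‖x‖³)`; far region: `|F| ≤ 16 C₄ ‖x‖⁻⁴` on `B(x, ‖x‖/4)` against
`∫_{B(x,‖x‖/4)} ‖DΓ(x − y)‖ dy = 3|B₁|‖x‖/(16π)`, and `‖DΓ(x − y)‖ ≤ 4/(π‖x‖²)` elsewhere against
`∫_{‖y‖>‖x‖/2} |F| ≤ 2‖x‖⁻¹ ∫‖y‖|F|`). The kernel half of the `∇G ∧ A` term of Lemarié-Rieusset's
(4.37) (`A = ∫ω`; «`A = 0 ⇒ u = O(|x|⁻³)`»).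
[cite: LemarieRieusset2016, §4.10 eq. (4.37) (p. 63)] [cite: GilbargTrudinger2001, (2.12)–(2.14)] -/
theorem abs_integral_fderiv_newtonKernel_sub_monopole_le {F : EuclideanSpace ℝ (Fin 3) → ℝ}
    (hFi : Integrable F volume) (hM1 : Integrable (fun y ↦ ‖y‖ * F y) volume) {C₄ : ℝ}
    (hC₄ : ∀ y, ‖y‖ ^ 4 * |F y| ≤ C₄) {x : EuclideanSpace ℝ (Fin 3)} (hx : 4 ≤ ‖x‖)
    (a : EuclideanSpace ℝ (Fin 3)) :
    |(∫ y, fderiv ℝ newtonKernel (x - y) a * F y) - (∫ y, F y) * fderiv ℝ newtonKernel x a| ≤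
      ((17 / (2 * π)) * (∫ y, ‖y‖ * |F y|) +
        (3 * (volume : Measure (EuclideanSpace ℝ (Fin 3))).real (ball 0 1) / π) * C₄) * ‖a‖ * ‖x‖⁻¹ ^ 3 := by
  have hx0 : 0 < ‖x‖ := lt_of_lt_of_le (by norm_num) hx
  have hxne : x ≠ 0 := norm_pos_iff.1 hx0
  have hC0 : 0 ≤ C₄ := le_trans (by positivity) (hC₄ 0)
  set I₁ : ℝ := ∫ y, ‖y‖ * |F y| with hI₁
  have hMi : Integrable (fun y ↦ ‖y‖ * |F y|) volume := by
    refine hM1.abs.congr (Eventually.of_forall fun y ↦ ?_)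
    simp only [abs_mul, abs_norm]
  have hI0 : 0 ≤ I₁ := integral_nonneg fun y ↦ by positivity
  -- the difference as one integral
  have hint := (integrable_fderiv_newtonKernel_sub_mul hFi (abs_le_of_pow_mul_abs_le_of_mem_ball hC₄ hx) a).1
  have hdiff : (∫ y, fderiv ℝ newtonKernel (x - y) a * F y) - (∫ y, F y) * fderiv ℝ newtonKernel x a =
      ∫ y, (fderiv ℝ newtonKernel (x - y) a - fderiv ℝ newtonKernel x a) * F y := by
    rw [← integral_mul_const, ← integral_sub hint (hFi.mul_const _)]
    exact integral_congr_ae (Eventually.of_forall fun y ↦ by ring)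
  rw [hdiff]
  -- radius of the ball about `x`
  set r : ℝ := ‖x‖ / 4 with hr
  have hr0 : 0 < r := by positivity
  obtain ⟨hIr, hIrv⟩ := integral_indicator_ball_norm_fderiv_newtonKernel x hr0
  -- the global majorant
  set g : EuclideanSpace ℝ (Fin 3) → ℝ := fun y ↦ (17 / (2 * π * ‖x‖ ^ 3)) * ‖a‖ * (‖y‖ * |F y|) +
    16 * C₄ * ‖a‖ * ‖x‖⁻¹ ^ 4 * (ball x r).indicator (fun y ↦ ‖fderiv ℝ newtonKernel (x - y)‖) y with hg
  have hgi : Integrable g volume := (hMi.const_mul _).add (hIr.const_mul _)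
  -- kernel bounds used in both regions
  have hKa : ∀ y, |fderiv ℝ newtonKernel (x - y) a| ≤ ‖fderiv ℝ newtonKernel (x - y)‖ * ‖a‖ := fun y ↦ by
    rw [← Real.norm_eq_abs]; exact ContinuousLinearMap.le_opNorm _ _
  have hKx : |fderiv ℝ newtonKernel x a| ≤ (4 * π * ‖x‖ ^ 2)⁻¹ * ‖a‖ := by
    rw [← Real.norm_eq_abs, ← norm_fderiv_newtonKernel hxne]; exact ContinuousLinearMap.le_opNorm _ _
  have hptw : ∀ y, ‖(fderiv ℝ newtonKernel (x - y) a - fderiv ℝ newtonKernel x a) * F y‖ ≤ g y := by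
    intro y
    rw [norm_mul, Real.norm_eq_abs, Real.norm_eq_abs]
    simp only [hg]
    have hyF0 : 0 ≤ ‖y‖ * |F y| := by positivity
    have hind0 : 0 ≤ (ball x r).indicator (fun y ↦ ‖fderiv ℝ newtonKernel (x - y)‖) y :=
      Set.indicator_nonneg (fun _ _ ↦ norm_nonneg _) _
    have hsecond0 : 0 ≤ 16 * C₄ * ‖a‖ * ‖x‖⁻¹ ^ 4 *
        (ball x r).indicator (fun y ↦ ‖fderiv ℝ newtonKernel (x - y)‖) y := by positivity
    by_cases hyA : ‖y‖ ≤ ‖x‖ / 2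
    · -- near region: increment bound of `DΓ`
      have h1 : |fderiv ℝ newtonKernel (x - y) a - fderiv ℝ newtonKernel x a| ≤ 8 * ‖y‖ / (π * ‖x‖ ^ 3) * ‖a‖ := by
        have e : fderiv ℝ newtonKernel (x - y) a - fderiv ℝ newtonKernel x a =
            (fderiv ℝ newtonKernel (x - y) - fderiv ℝ newtonKernel x) a := rfl
        rw [e, ← Real.norm_eq_abs]
        exact (ContinuousLinearMap.le_opNorm _ _).trans
          (mul_le_mul_of_nonneg_right (norm_fderiv_newtonKernel_sub_sub_le hxne hyA) (norm_nonneg _))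
      calc |fderiv ℝ newtonKernel (x - y) a - fderiv ℝ newtonKernel x a| * |F y|
          ≤ 8 * ‖y‖ / (π * ‖x‖ ^ 3) * ‖a‖ * |F y| := mul_le_mul_of_nonneg_right h1 (abs_nonneg _)
        _ = (16 / (2 * π * ‖x‖ ^ 3)) * ‖a‖ * (‖y‖ * |F y|) := by
            field_simp
            ring
        _ ≤ (17 / (2 * π * ‖x‖ ^ 3)) * ‖a‖ * (‖y‖ * |F y|) := by gcongr; norm_num
        _ ≤ (17 / (2 * π * ‖x‖ ^ 3)) * ‖a‖ * (‖y‖ * |F y|) + 16 * C₄ * ‖a‖ * ‖x‖⁻¹ ^ 4 *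
              (ball x r).indicator (fun y ↦ ‖fderiv ℝ newtonKernel (x - y)‖) y :=
            le_add_of_nonneg_right hsecond0
    · -- far region: `‖y‖ > ‖x‖/2`
      rw [not_le] at hyA
      have hy0 : 0 < ‖y‖ := lt_trans (by positivity) hyA
      have hF1 : |F y| ≤ (2 / ‖x‖) * (‖y‖ * |F y|) := by
        have : 1 ≤ (2 / ‖x‖) * ‖y‖ := by
          rw [div_mul_eq_mul_div, le_div_iff₀ hx0]; linarith
        nlinarith [abs_nonneg (F y)]
      have hF2 : |F y| ≤ 16 * C₄ * ‖x‖⁻¹ ^ 4 := by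
        have h4 : (‖x‖ / 2) ^ 4 ≤ ‖y‖ ^ 4 := pow_le_pow_left₀ (by positivity) hyA.le 4
        have := hC₄ y
        have hx4 : (‖x‖ / 2) ^ 4 * |F y| ≤ C₄ :=
          le_trans (mul_le_mul_of_nonneg_right h4 (abs_nonneg _)) this
        have hx4' : ‖x‖ ^ 4 * |F y| ≤ 16 * C₄ := by nlinarith
        rw [inv_pow, ← div_eq_mul_inv, le_div_iff₀ (by positivity)]
        linarith
      -- the `∂ₐΓ(x) F(y)` part
      have hpart2 : |fderiv ℝ newtonKernel x a| * |F y| ≤ (1 / (2 * π * ‖x‖ ^ 3)) * ‖a‖ * (‖y‖ * |F y|) := by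
        calc |fderiv ℝ newtonKernel x a| * |F y|
            ≤ (4 * π * ‖x‖ ^ 2)⁻¹ * ‖a‖ * ((2 / ‖x‖) * (‖y‖ * |F y|)) :=
              mul_le_mul hKx hF1 (abs_nonneg _) (by positivity)
          _ = (1 / (2 * π * ‖x‖ ^ 3)) * ‖a‖ * (‖y‖ * |F y|) := by
              field_simp
              ring
      -- the `∂ₐΓ(x - y) F(y)` part
      have hpart1 : |fderiv ℝ newtonKernel (x - y) a| * |F y| ≤
          (16 / (2 * π * ‖x‖ ^ 3)) * ‖a‖ * (‖y‖ * |F y|) +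
            16 * C₄ * ‖a‖ * ‖x‖⁻¹ ^ 4 * (ball x r).indicator (fun y ↦ ‖fderiv ℝ newtonKernel (x - y)‖) y := by
        by_cases hyB : y ∈ ball x r
        · rw [indicator_of_mem hyB]
          have h0 : 0 ≤ (16 / (2 * π * ‖x‖ ^ 3)) * ‖a‖ * (‖y‖ * |F y|) := by positivity
          calc |fderiv ℝ newtonKernel (x - y) a| * |F y|
              ≤ ‖fderiv ℝ newtonKernel (x - y)‖ * ‖a‖ * (16 * C₄ * ‖x‖⁻¹ ^ 4) :=
                mul_le_mul (hKa y) hF2 (abs_nonneg _) (by positivity)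
            _ = 16 * C₄ * ‖a‖ * ‖x‖⁻¹ ^ 4 * ‖fderiv ℝ newtonKernel (x - y)‖ := by ring
            _ ≤ _ := le_add_of_nonneg_left h0
        · rw [indicator_of_notMem hyB, mul_zero, add_zero]
          have hxy : r ≤ ‖x - y‖ := by
            rw [mem_ball, dist_eq_norm, not_lt, norm_sub_rev] at hyB; exact hyB
          have hxy0 : 0 < ‖x - y‖ := lt_of_lt_of_le hr0 hxy
          have hxyne : x - y ≠ 0 := norm_pos_iff.1 hxy0
          have hΓ : ‖fderiv ℝ newtonKernel (x - y)‖ ≤ 4 / (π * ‖x‖ ^ 2) := by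
            rw [norm_fderiv_newtonKernel hxyne, inv_eq_one_div,
              div_le_div_iff₀ (by positivity) (by positivity), one_mul]
            rw [hr] at hxy
            have h2 : (‖x‖ / 4) ^ 2 ≤ ‖x - y‖ ^ 2 := pow_le_pow_left₀ (by positivity) hxy 2
            nlinarith [pi_pos, h2]
          calc |fderiv ℝ newtonKernel (x - y) a| * |F y|
              ≤ ‖fderiv ℝ newtonKernel (x - y)‖ * ‖a‖ * ((2 / ‖x‖) * (‖y‖ * |F y|)) :=
                mul_le_mul (hKa y) hF1 (abs_nonneg _) (by positivity)
            _ ≤ 4 / (π * ‖x‖ ^ 2) * ‖a‖ * ((2 / ‖x‖) * (‖y‖ * |F y|)) := by gcongr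
            _ = (16 / (2 * π * ‖x‖ ^ 3)) * ‖a‖ * (‖y‖ * |F y|) := by
                field_simp
                ring
      calc |fderiv ℝ newtonKernel (x - y) a - fderiv ℝ newtonKernel x a| * |F y|
          ≤ (|fderiv ℝ newtonKernel (x - y) a| + |fderiv ℝ newtonKernel x a|) * |F y| :=
            mul_le_mul_of_nonneg_right (abs_sub _ _) (abs_nonneg _)
        _ = |fderiv ℝ newtonKernel (x - y) a| * |F y| + |fderiv ℝ newtonKernel x a| * |F y| := by ring
        _ ≤ ((16 / (2 * π * ‖x‖ ^ 3)) * ‖a‖ * (‖y‖ * |F y|) +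
              16 * C₄ * ‖a‖ * ‖x‖⁻¹ ^ 4 * (ball x r).indicator (fun y ↦ ‖fderiv ℝ newtonKernel (x - y)‖) y) +
            (1 / (2 * π * ‖x‖ ^ 3)) * ‖a‖ * (‖y‖ * |F y|) := add_le_add hpart1 hpart2
        _ = (17 / (2 * π * ‖x‖ ^ 3)) * ‖a‖ * (‖y‖ * |F y|) + 16 * C₄ * ‖a‖ * ‖x‖⁻¹ ^ 4 *
              (ball x r).indicator (fun y ↦ ‖fderiv ℝ newtonKernel (x - y)‖) y := by ring
  -- integrate the majorant
  have hle := norm_integral_le_of_norm_le hgi (Eventually.of_forall hptw)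
  rw [Real.norm_eq_abs] at hle
  refine hle.trans (le_of_eq ?_)
  rw [hg, integral_add (hMi.const_mul _) (hIr.const_mul _), integral_const_mul, integral_const_mul, hIrv,
    hr]
  field_simp
  ring

/-- **Mean-zero densities: `∇(Γ ⋆ F) = O(|x|⁻³)`.** Under the hypotheses of
`abs_integral_fderiv_newtonKernel_sub_monopole_le` and `∫ F = 0`:
`|∫ ∂ₐΓ(x − y) F(y) dy| ≤ ((17/(2π)) ∫‖y‖|F| + (3|B₁|/π) C₄) ‖a‖ ‖x‖⁻³` for `‖x‖ ≥ 4` («`A = 0 ⇒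
u = O(|x|⁻³)`»). [cite: LemarieRieusset2016, §4.10 eq. (4.37) (p. 63)] -/
theorem abs_integral_fderiv_newtonKernel_mul_le_of_integral_eq_zero {F : EuclideanSpace ℝ (Fin 3) → ℝ}
    (hFi : Integrable F volume) (hM1 : Integrable (fun y ↦ ‖y‖ * F y) volume) {C₄ : ℝ}
    (hC₄ : ∀ y, ‖y‖ ^ 4 * |F y| ≤ C₄) (h0 : ∫ y, F y = 0) {x : EuclideanSpace ℝ (Fin 3)} (hx : 4 ≤ ‖x‖)
    (a : EuclideanSpace ℝ (Fin 3)) :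
    |∫ y, fderiv ℝ newtonKernel (x - y) a * F y| ≤
      ((17 / (2 * π)) * (∫ y, ‖y‖ * |F y|) +
        (3 * (volume : Measure (EuclideanSpace ℝ (Fin 3))).real (ball 0 1) / π) * C₄) * ‖a‖ * ‖x‖⁻¹ ^ 3 := by
  have h := abs_integral_fderiv_newtonKernel_sub_monopole_le hFi hM1 hC₄ hx a
  rwa [h0, zero_mul, sub_zero] at h

end FirstOrder

/-! ### The far-field expansion of the gradient potential, second order -/

section SecondOrder

/-- Pointwise bound of the second-order remainder integrand in the NEAR region `‖y‖ ≤ ‖x‖/2`: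
`|(∂ₐΓ(x − y) − ∂ₐΓ(x) + D²Γ(x)[y, a]) F(y)| ≤ M ‖a‖ ‖x‖⁻⁴ ‖y‖² |F(y)|`, `M` the constant of
`exists_norm_fderiv_newtonKernel_taylor_two_le`. [cite: GilbargTrudinger2001, (2.12)–(2.14)] -/
private theorem abs_taylorTwo_mul_le_near {M : ℝ}
    (hM : ∀ {x y : EuclideanSpace ℝ (Fin 3)}, x ≠ 0 → ‖y‖ ≤ ‖x‖ / 2 →
      ‖fderiv ℝ newtonKernel (x - y) - fderiv ℝ newtonKernel x + fderiv ℝ (fderiv ℝ newtonKernel) x y‖ ≤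
        M * ‖y‖ ^ 2 / ‖x‖ ^ 4)
    (F : EuclideanSpace ℝ (Fin 3) → ℝ) {x y : EuclideanSpace ℝ (Fin 3)} (hx : x ≠ 0) (hyA : ‖y‖ ≤ ‖x‖ / 2)
    (a : EuclideanSpace ℝ (Fin 3)) :
    |fderiv ℝ newtonKernel (x - y) a - fderiv ℝ newtonKernel x a + fderiv ℝ (fderiv ℝ newtonKernel) x y a| * |F y| ≤
      M * ‖a‖ * ‖x‖⁻¹ ^ 4 * (‖y‖ ^ 2 * |F y|) := by
  have hx0 : 0 < ‖x‖ := norm_pos_iff.2 hx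
  have h1 : |fderiv ℝ newtonKernel (x - y) a - fderiv ℝ newtonKernel x a +
      fderiv ℝ (fderiv ℝ newtonKernel) x y a| ≤ M * ‖y‖ ^ 2 / ‖x‖ ^ 4 * ‖a‖ := by
    have e : fderiv ℝ newtonKernel (x - y) a - fderiv ℝ newtonKernel x a +
        fderiv ℝ (fderiv ℝ newtonKernel) x y a =
        (fderiv ℝ newtonKernel (x - y) - fderiv ℝ newtonKernel x + fderiv ℝ (fderiv ℝ newtonKernel) x y) a := rfl
    rw [e, ← Real.norm_eq_abs]
    exact (ContinuousLinearMap.le_opNorm _ _).trans (mul_le_mul_of_nonneg_right (hM hx hyA) (norm_nonneg _))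
  calc |fderiv ℝ newtonKernel (x - y) a - fderiv ℝ newtonKernel x a +
        fderiv ℝ (fderiv ℝ newtonKernel) x y a| * |F y|
      ≤ M * ‖y‖ ^ 2 / ‖x‖ ^ 4 * ‖a‖ * |F y| := mul_le_mul_of_nonneg_right h1 (abs_nonneg _)
    _ = M * ‖a‖ * ‖x‖⁻¹ ^ 4 * (‖y‖ ^ 2 * |F y|) := by
        rw [inv_pow, div_eq_mul_inv]
        ring

/-- Pointwise bound of the second-order remainder integrand in the FAR region `‖y‖ > ‖x‖/2`
(`‖x‖ ≥ 4`, `‖y‖⁵ |F(y)| ≤ C₅`): the three terms separately, `|F(y)| ≤ 4‖x‖⁻² ‖y‖²|F(y)|` off the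
ball `B(x, ‖x‖/4)` and `|F(y)| ≤ 32 C₅ ‖x‖⁻⁵` on it. [cite: GilbargTrudinger2001, (2.12)–(2.14)] -/
private theorem abs_taylorTwo_mul_le_far (F : EuclideanSpace ℝ (Fin 3) → ℝ) {C₅ : ℝ}
    {x y : EuclideanSpace ℝ (Fin 3)} (hx : 4 ≤ ‖x‖) (hyA : ‖x‖ / 2 < ‖y‖) (hC₅ : ‖y‖ ^ 5 * |F y| ≤ C₅)
    (a : EuclideanSpace ℝ (Fin 3)) :
    |fderiv ℝ newtonKernel (x - y) a - fderiv ℝ newtonKernel x a + fderiv ℝ (fderiv ℝ newtonKernel) x y a| * |F y| ≤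
      (19 / π) * ‖a‖ * ‖x‖⁻¹ ^ 4 * (‖y‖ ^ 2 * |F y|) +
        32 * C₅ * ‖a‖ * ‖x‖⁻¹ ^ 5 * (ball x (‖x‖ / 4)).indicator (fun y ↦ ‖fderiv ℝ newtonKernel (x - y)‖) y := by
  have hx0 : 0 < ‖x‖ := lt_of_lt_of_le (by norm_num) hx
  have hxne : x ≠ 0 := norm_pos_iff.1 hx0
  have hy0 : 0 < ‖y‖ := lt_trans (by positivity) hyA
  have hx4 : ‖x‖⁻¹ ^ 4 = (‖x‖ ^ 4)⁻¹ := by rw [inv_pow]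
  have hyF0 : 0 ≤ ‖y‖ ^ 2 * |F y| := by positivity
  -- kernel bounds
  have hKa : |fderiv ℝ newtonKernel (x - y) a| ≤ ‖fderiv ℝ newtonKernel (x - y)‖ * ‖a‖ := by
    rw [← Real.norm_eq_abs]; exact ContinuousLinearMap.le_opNorm _ _
  have hKx : |fderiv ℝ newtonKernel x a| ≤ (4 * π * ‖x‖ ^ 2)⁻¹ * ‖a‖ := by
    rw [← Real.norm_eq_abs, ← norm_fderiv_newtonKernel hxne]; exact ContinuousLinearMap.le_opNorm _ _
  have hK2 : |fderiv ℝ (fderiv ℝ newtonKernel) x y a| ≤ 1 / (π * ‖x‖ ^ 3) * ‖y‖ * ‖a‖ := by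
    rw [← Real.norm_eq_abs]
    calc ‖fderiv ℝ (fderiv ℝ newtonKernel) x y a‖ ≤ ‖fderiv ℝ (fderiv ℝ newtonKernel) x y‖ * ‖a‖ :=
          ContinuousLinearMap.le_opNorm _ _
      _ ≤ ‖fderiv ℝ (fderiv ℝ newtonKernel) x‖ * ‖y‖ * ‖a‖ := by
          gcongr; exact ContinuousLinearMap.le_opNorm _ _
      _ ≤ 1 / (π * ‖x‖ ^ 3) * ‖y‖ * ‖a‖ := by gcongr; exact norm_fderiv2_newtonKernel_le hxne
  -- decay bounds in the far region
  have hF1 : |F y| ≤ (4 / ‖x‖ ^ 2) * (‖y‖ ^ 2 * |F y|) := by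
    have h2 : (‖x‖ / 2) ^ 2 ≤ ‖y‖ ^ 2 := pow_le_pow_left₀ (by positivity) hyA.le 2
    have h3 : 1 ≤ (4 / ‖x‖ ^ 2) * ‖y‖ ^ 2 := by
      rw [div_mul_eq_mul_div, le_div_iff₀ (by positivity)]; nlinarith
    nlinarith [abs_nonneg (F y)]
  have hF1' : ‖y‖ * |F y| ≤ (2 / ‖x‖) * (‖y‖ ^ 2 * |F y|) := by
    have h3 : ‖y‖ ≤ (2 / ‖x‖) * ‖y‖ ^ 2 := by
      rw [div_mul_eq_mul_div, le_div_iff₀ hx0]; nlinarith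
    nlinarith [abs_nonneg (F y)]
  have hF2 : |F y| ≤ 32 * C₅ * ‖x‖⁻¹ ^ 5 := by
    have h5 : (‖x‖ / 2) ^ 5 ≤ ‖y‖ ^ 5 := pow_le_pow_left₀ (by positivity) hyA.le 5
    have hx5' : (‖x‖ / 2) ^ 5 * |F y| ≤ C₅ := le_trans (mul_le_mul_of_nonneg_right h5 (abs_nonneg _)) hC₅
    have e : (‖x‖ / 2) ^ 5 * |F y| = ‖x‖ ^ 5 * |F y| / 32 := by ring
    rw [e, div_le_iff₀ (by norm_num)] at hx5'
    rw [inv_pow, ← div_eq_mul_inv, le_div_iff₀ (by positivity)]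
    linarith
  -- the `∂ₐΓ(x) F(y)` part
  have hpart2 : |fderiv ℝ newtonKernel x a| * |F y| ≤ (1 / π) * ‖a‖ * ‖x‖⁻¹ ^ 4 * (‖y‖ ^ 2 * |F y|) := by
    calc |fderiv ℝ newtonKernel x a| * |F y|
        ≤ (4 * π * ‖x‖ ^ 2)⁻¹ * ‖a‖ * ((4 / ‖x‖ ^ 2) * (‖y‖ ^ 2 * |F y|)) :=
          mul_le_mul hKx hF1 (abs_nonneg _) (by positivity)
      _ = (1 / π) * ‖a‖ * ‖x‖⁻¹ ^ 4 * (‖y‖ ^ 2 * |F y|) := by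
          rw [hx4]
          field_simp
  -- the dipole part `D²Γ(x)[y, a] F(y)`
  have hpart3 : |fderiv ℝ (fderiv ℝ newtonKernel) x y a| * |F y| ≤
      (2 / π) * ‖a‖ * ‖x‖⁻¹ ^ 4 * (‖y‖ ^ 2 * |F y|) := by
    calc |fderiv ℝ (fderiv ℝ newtonKernel) x y a| * |F y|
        ≤ 1 / (π * ‖x‖ ^ 3) * ‖y‖ * ‖a‖ * |F y| := mul_le_mul_of_nonneg_right hK2 (abs_nonneg _)
      _ = 1 / (π * ‖x‖ ^ 3) * ‖a‖ * (‖y‖ * |F y|) := by ring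
      _ ≤ 1 / (π * ‖x‖ ^ 3) * ‖a‖ * ((2 / ‖x‖) * (‖y‖ ^ 2 * |F y|)) := by gcongr
      _ = (2 / π) * ‖a‖ * ‖x‖⁻¹ ^ 4 * (‖y‖ ^ 2 * |F y|) := by
          rw [hx4]
          field_simp
  -- the `∂ₐΓ(x - y) F(y)` part
  have hpart1 : |fderiv ℝ newtonKernel (x - y) a| * |F y| ≤
      (16 / π) * ‖a‖ * ‖x‖⁻¹ ^ 4 * (‖y‖ ^ 2 * |F y|) +
        32 * C₅ * ‖a‖ * ‖x‖⁻¹ ^ 5 * (ball x (‖x‖ / 4)).indicator (fun y ↦ ‖fderiv ℝ newtonKernel (x - y)‖) y := by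
    by_cases hyB : y ∈ ball x (‖x‖ / 4)
    · rw [indicator_of_mem hyB]
      have h0 : 0 ≤ (16 / π) * ‖a‖ * ‖x‖⁻¹ ^ 4 * (‖y‖ ^ 2 * |F y|) := by positivity
      calc |fderiv ℝ newtonKernel (x - y) a| * |F y|
          ≤ ‖fderiv ℝ newtonKernel (x - y)‖ * ‖a‖ * (32 * C₅ * ‖x‖⁻¹ ^ 5) :=
            mul_le_mul hKa hF2 (abs_nonneg _) (by positivity)
        _ = 32 * C₅ * ‖a‖ * ‖x‖⁻¹ ^ 5 * ‖fderiv ℝ newtonKernel (x - y)‖ := by ring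
        _ ≤ _ := le_add_of_nonneg_left h0
    · rw [indicator_of_notMem hyB, mul_zero, add_zero]
      have hxy : ‖x‖ / 4 ≤ ‖x - y‖ := by
        rw [mem_ball, dist_eq_norm, not_lt, norm_sub_rev] at hyB; exact hyB
      have hxy0 : 0 < ‖x - y‖ := lt_of_lt_of_le (by positivity) hxy
      have hxyne : x - y ≠ 0 := norm_pos_iff.1 hxy0
      have hΓ : ‖fderiv ℝ newtonKernel (x - y)‖ ≤ 4 / (π * ‖x‖ ^ 2) := by
        rw [norm_fderiv_newtonKernel hxyne, inv_eq_one_div,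
          div_le_div_iff₀ (by positivity) (by positivity), one_mul]
        have h2 : (‖x‖ / 4) ^ 2 ≤ ‖x - y‖ ^ 2 := pow_le_pow_left₀ (by positivity) hxy 2
        nlinarith [pi_pos, h2]
      calc |fderiv ℝ newtonKernel (x - y) a| * |F y|
          ≤ ‖fderiv ℝ newtonKernel (x - y)‖ * ‖a‖ * ((4 / ‖x‖ ^ 2) * (‖y‖ ^ 2 * |F y|)) :=
            mul_le_mul hKa hF1 (abs_nonneg _) (by positivity)
        _ ≤ 4 / (π * ‖x‖ ^ 2) * ‖a‖ * ((4 / ‖x‖ ^ 2) * (‖y‖ ^ 2 * |F y|)) := by gcongr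
        _ = (16 / π) * ‖a‖ * ‖x‖⁻¹ ^ 4 * (‖y‖ ^ 2 * |F y|) := by
            rw [hx4]
            field_simp
            ring
  calc |fderiv ℝ newtonKernel (x - y) a - fderiv ℝ newtonKernel x a +
        fderiv ℝ (fderiv ℝ newtonKernel) x y a| * |F y|
      ≤ (|fderiv ℝ newtonKernel (x - y) a| + |fderiv ℝ newtonKernel x a| +
          |fderiv ℝ (fderiv ℝ newtonKernel) x y a|) * |F y| := by
        refine mul_le_mul_of_nonneg_right ((abs_add_le _ _).trans ?_) (abs_nonneg _)
        gcongr
        exact abs_sub _ _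
    _ = |fderiv ℝ newtonKernel (x - y) a| * |F y| + |fderiv ℝ newtonKernel x a| * |F y| +
          |fderiv ℝ (fderiv ℝ newtonKernel) x y a| * |F y| := by ring
    _ ≤ ((16 / π) * ‖a‖ * ‖x‖⁻¹ ^ 4 * (‖y‖ ^ 2 * |F y|) +
          32 * C₅ * ‖a‖ * ‖x‖⁻¹ ^ 5 * (ball x (‖x‖ / 4)).indicator (fun y ↦ ‖fderiv ℝ newtonKernel (x - y)‖) y) +
        (1 / π) * ‖a‖ * ‖x‖⁻¹ ^ 4 * (‖y‖ ^ 2 * |F y|) +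
        (2 / π) * ‖a‖ * ‖x‖⁻¹ ^ 4 * (‖y‖ ^ 2 * |F y|) := add_le_add (add_le_add hpart1 hpart2) hpart3
    _ = (19 / π) * ‖a‖ * ‖x‖⁻¹ ^ 4 * (‖y‖ ^ 2 * |F y|) + 32 * C₅ * ‖a‖ * ‖x‖⁻¹ ^ 5 *
          (ball x (‖x‖ / 4)).indicator (fun y ↦ ‖fderiv ℝ newtonKernel (x - y)‖) y := by ring

/-- **Far-field expansion of the gradient of the Newtonian potential, second order (monopole and
dipole terms).** There is an absolute constant `K > 0` such that: for every integrable
`F : ℝ³ → ℝ` with finite second moment `∫ ‖y‖² |F(y)| dy < ∞` and quintic decay `‖y‖⁵ |F(y)| ≤ C₅`,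
every `‖x‖ ≥ 4` and every direction `a`, the gradient potential `V_a(x) = ∫ ∂ₐΓ(x − y) F(y) dy`
satisfies

  `|V_a(x) − Q ∂ₐΓ(x) + D²Γ(x)[m, a]| ≤ K (∫‖y‖²|F| + C₅) ‖a‖ ‖x‖⁻⁴`,
  `Q = ∫ F(y) dy`, `m = ∫ F(y) y dy`

— i.e. `∇(Γ ⋆ F)(x) = Q ∇Γ(x) − D²Γ(x) m + O(|x|⁻⁴)`, the monopole and dipole terms of the
multipole expansion (near region `‖y‖ ≤ ‖x‖/2`: the second-order Taylor increment
`‖DΓ(x − y) − DΓ(x) + D²Γ(x)[y]‖ ≤ M‖y‖²/‖x‖⁴` of `exists_norm_fderiv_newtonKernel_taylor_two_le`;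
far region: `|F| ≤ 32 C₅‖x‖⁻⁵` on `B(x, ‖x‖/4)` against `∫_{B(x,‖x‖/4)} ‖DΓ(x − y)‖ dy = 3|B₁|‖x‖/(16π)`,
`‖DΓ(x − y)‖ ≤ 4/(π‖x‖²)`, `‖DΓ(x)‖ = (4π‖x‖²)⁻¹`, `‖D²Γ(x)‖ ≤ (π‖x‖³)⁻¹` elsewhere against
`∫_{‖y‖>‖x‖/2} |F| ≤ 4‖x‖⁻² ∫‖y‖²|F|`; `K = M + 19/π + 6|B₁|/π`). The kernel half of the
`∇G ∧ A + Σᵢ ∇∂ᵢG ∧ Bᵢ` terms of Lemarié-Rieusset's (4.37) (`A = ∫ω`, `Bᵢ = −∫yᵢω`).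
[cite: LemarieRieusset2016, §4.10 eq. (4.37) (p. 63)] [cite: GilbargTrudinger2001, (2.12)–(2.14)] -/
theorem exists_abs_integral_fderiv_newtonKernel_sub_dipole_le :
    ∃ K : ℝ, 0 < K ∧ ∀ {F : EuclideanSpace ℝ (Fin 3) → ℝ}, Integrable F volume →
      Integrable (fun y ↦ ‖y‖ ^ 2 * F y) volume → ∀ {C₅ : ℝ}, (∀ y, ‖y‖ ^ 5 * |F y| ≤ C₅) →
      ∀ {x : EuclideanSpace ℝ (Fin 3)}, 4 ≤ ‖x‖ → ∀ a : EuclideanSpace ℝ (Fin 3),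
        |(∫ y, fderiv ℝ newtonKernel (x - y) a * F y) - (∫ y, F y) * fderiv ℝ newtonKernel x a +
            fderiv ℝ (fderiv ℝ newtonKernel) x (∫ y, F y • y) a| ≤
          K * ((∫ y, ‖y‖ ^ 2 * |F y|) + C₅) * ‖a‖ * ‖x‖⁻¹ ^ 4 := by
  obtain ⟨M, hM0, hM⟩ := exists_norm_fderiv_newtonKernel_taylor_two_le
  have hV₁0 : 0 ≤ (volume : Measure (EuclideanSpace ℝ (Fin 3))).real (ball 0 1) := measureReal_nonneg
  refine ⟨M + 19 / π + 6 * (volume : Measure (EuclideanSpace ℝ (Fin 3))).real (ball 0 1) / π,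
    by positivity, fun {F} hFi hM2 {C₅} hC₅ {x} hx a ↦ ?_⟩
  have hx0 : 0 < ‖x‖ := lt_of_lt_of_le (by norm_num) hx
  have hxne : x ≠ 0 := norm_pos_iff.1 hx0
  have hC0 : 0 ≤ C₅ := le_trans (by positivity) (hC₅ 0)
  have hM1 : Integrable (fun y ↦ ‖y‖ * F y) volume := integrable_norm_mul_of_sq hFi hM2
  have hMv : Integrable (fun y ↦ F y • y) volume := integrable_smul_self_of_norm_mul hFi hM1
  have hMi : Integrable (fun y ↦ ‖y‖ ^ 2 * |F y|) volume := by
    refine hM2.abs.congr (Eventually.of_forall fun y ↦ ?_)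
    simp only [abs_mul, abs_pow, abs_norm]
  have hI0 : 0 ≤ ∫ y, ‖y‖ ^ 2 * |F y| := integral_nonneg fun y ↦ by positivity
  -- the three integrable pieces
  have hint := (integrable_fderiv_newtonKernel_sub_mul hFi (abs_le_of_pow_mul_abs_le_of_mem_ball hC₅ hx) a).1
  have hintK : Integrable (fun y ↦ F y * fderiv ℝ newtonKernel x a) volume := hFi.mul_const _
  have hLy : ∀ y, (fderiv ℝ (fderiv ℝ newtonKernel) x).flip a y = fderiv ℝ (fderiv ℝ newtonKernel) x y a :=
    fun y ↦ by rw [ContinuousLinearMap.flip_apply]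
  have hintD : Integrable (fun y ↦ fderiv ℝ (fderiv ℝ newtonKernel) x y a * F y) volume := by
    refine (((fderiv ℝ (fderiv ℝ newtonKernel) x).flip a).integrable_comp hMv).congr
      (Eventually.of_forall fun y ↦ ?_)
    show (fderiv ℝ (fderiv ℝ newtonKernel) x).flip a (F y • y) = _
    rw [map_smul, smul_eq_mul, hLy, mul_comm]
  have hintS : Integrable (fun y ↦ fderiv ℝ newtonKernel (x - y) a * F y - F y * fderiv ℝ newtonKernel x a)
      volume := hint.sub hintK
  have hdip := integral_fderiv2_newtonKernel_apply_mul hMv x a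
  -- the remainder as one integral
  have hdiff : (∫ y, fderiv ℝ newtonKernel (x - y) a * F y) - (∫ y, F y) * fderiv ℝ newtonKernel x a +
      fderiv ℝ (fderiv ℝ newtonKernel) x (∫ y, F y • y) a =
      ∫ y, (fderiv ℝ newtonKernel (x - y) a - fderiv ℝ newtonKernel x a +
        fderiv ℝ (fderiv ℝ newtonKernel) x y a) * F y := by
    have e1 : (∫ y, (fderiv ℝ newtonKernel (x - y) a - fderiv ℝ newtonKernel x a +
        fderiv ℝ (fderiv ℝ newtonKernel) x y a) * F y) =
        ∫ y, ((fderiv ℝ newtonKernel (x - y) a * F y - F y * fderiv ℝ newtonKernel x a) +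
          fderiv ℝ (fderiv ℝ newtonKernel) x y a * F y) :=
      integral_congr_ae (Eventually.of_forall fun y ↦ by ring)
    rw [e1, integral_add hintS hintD, integral_sub hint hintK, integral_mul_const, hdip]
  rw [hdiff]
  -- the global majorant
  have hr0 : 0 < ‖x‖ / 4 := by positivity
  obtain ⟨hIr, hIrv⟩ := integral_indicator_ball_norm_fderiv_newtonKernel x hr0
  have hgi : Integrable (fun y ↦ (M + 19 / π) * ‖a‖ * ‖x‖⁻¹ ^ 4 * (‖y‖ ^ 2 * |F y|) +
      32 * C₅ * ‖a‖ * ‖x‖⁻¹ ^ 5 * (ball x (‖x‖ / 4)).indicator (fun y ↦ ‖fderiv ℝ newtonKernel (x - y)‖) y)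
      volume := (hMi.const_mul _).add (hIr.const_mul _)
  have hptw : ∀ y, ‖(fderiv ℝ newtonKernel (x - y) a - fderiv ℝ newtonKernel x a +
      fderiv ℝ (fderiv ℝ newtonKernel) x y a) * F y‖ ≤
      (M + 19 / π) * ‖a‖ * ‖x‖⁻¹ ^ 4 * (‖y‖ ^ 2 * |F y|) +
        32 * C₅ * ‖a‖ * ‖x‖⁻¹ ^ 5 * (ball x (‖x‖ / 4)).indicator (fun y ↦ ‖fderiv ℝ newtonKernel (x - y)‖) y := by
    intro y
    rw [norm_mul, Real.norm_eq_abs, Real.norm_eq_abs]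
    have hyF0 : 0 ≤ ‖y‖ ^ 2 * |F y| := by positivity
    have hind0 : 0 ≤ (ball x (‖x‖ / 4)).indicator (fun y ↦ ‖fderiv ℝ newtonKernel (x - y)‖) y :=
      Set.indicator_nonneg (fun _ _ ↦ norm_nonneg _) _
    rcases le_or_gt ‖y‖ (‖x‖ / 2) with hyA | hyA
    · refine (abs_taylorTwo_mul_le_near hM F hxne hyA a).trans ?_
      have h2 : M * ‖a‖ * ‖x‖⁻¹ ^ 4 * (‖y‖ ^ 2 * |F y|) ≤ (M + 19 / π) * ‖a‖ * ‖x‖⁻¹ ^ 4 * (‖y‖ ^ 2 * |F y|) := by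
        gcongr
        exact le_add_of_nonneg_right (by positivity)
      nlinarith [h2, mul_nonneg (mul_nonneg (mul_nonneg (by norm_num : (0 : ℝ) ≤ 32) hC0) (norm_nonneg a))
        (mul_nonneg (pow_nonneg (inv_nonneg.2 hx0.le) 5) hind0)]
    · refine (abs_taylorTwo_mul_le_far F hx hyA (hC₅ y) a).trans ?_
      gcongr
      exact le_add_of_nonneg_left hM0
  -- integrate the majorant
  have hle := norm_integral_le_of_norm_le hgi (Eventually.of_forall hptw)
  rw [Real.norm_eq_abs, integral_add (hMi.const_mul _) (hIr.const_mul _), integral_const_mul,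
    integral_const_mul, hIrv] at hle
  refine hle.trans ?_
  have hx54 : ‖x‖⁻¹ ^ 5 * ‖x‖ = ‖x‖⁻¹ ^ 4 := by
    rw [pow_succ, mul_assoc, inv_mul_cancel₀ hx0.ne', mul_one]
  have hcalc : (M + 19 / π) * ‖a‖ * ‖x‖⁻¹ ^ 4 * (∫ y, ‖y‖ ^ 2 * |F y|) +
      32 * C₅ * ‖a‖ * ‖x‖⁻¹ ^ 5 *
        (3 * (volume : Measure (EuclideanSpace ℝ (Fin 3))).real (ball 0 1) * (‖x‖ / 4) / (4 * π)) =
      ((M + 19 / π) * (∫ y, ‖y‖ ^ 2 * |F y|) +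
        (6 * (volume : Measure (EuclideanSpace ℝ (Fin 3))).real (ball 0 1) / π) * C₅) * (‖a‖ * ‖x‖⁻¹ ^ 4) := by
    rw [← hx54]
    field_simp
    ring
  rw [hcalc]
  have hcoef : (M + 19 / π) * (∫ y, ‖y‖ ^ 2 * |F y|) +
      (6 * (volume : Measure (EuclideanSpace ℝ (Fin 3))).real (ball 0 1) / π) * C₅ ≤
      (M + 19 / π + 6 * (volume : Measure (EuclideanSpace ℝ (Fin 3))).real (ball 0 1) / π) *
        ((∫ y, ‖y‖ ^ 2 * |F y|) + C₅) := by
    have h1 : 0 ≤ 6 * (volume : Measure (EuclideanSpace ℝ (Fin 3))).real (ball 0 1) / π := by positivity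
    have h2 : 0 ≤ M + 19 / π := by positivity
    nlinarith [mul_nonneg h1 hI0, mul_nonneg h2 hC0]
  calc ((M + 19 / π) * (∫ y, ‖y‖ ^ 2 * |F y|) +
        (6 * (volume : Measure (EuclideanSpace ℝ (Fin 3))).real (ball 0 1) / π) * C₅) * (‖a‖ * ‖x‖⁻¹ ^ 4)
      ≤ (M + 19 / π + 6 * (volume : Measure (EuclideanSpace ℝ (Fin 3))).real (ball 0 1) / π) *
          ((∫ y, ‖y‖ ^ 2 * |F y|) + C₅) * (‖a‖ * ‖x‖⁻¹ ^ 4) :=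
        mul_le_mul_of_nonneg_right hcoef (by positivity)
    _ = _ := by ring

end SecondOrder

/-! ### Corollaries: vanishing moments, and the global weighted forms -/

section Corollaries

/-- **Mean-zero densities with vanishing first moments: `∇(Γ ⋆ F) = O(|x|⁻⁴)`.** With the constant
`K` of `exists_abs_integral_fderiv_newtonKernel_sub_dipole_le`: if moreover `∫ F = 0` and
`∫ F(y) y dy = 0`, then `|∫ ∂ₐΓ(x − y) F(y) dy| ≤ K (∫‖y‖²|F| + C₅) ‖a‖ ‖x‖⁻⁴` for `‖x‖ ≥ 4` — the
«zero total vorticity and zero impulse ⇒ `|x|⁻⁴` tails» reading of Lemarié-Rieusset's (4.37)–(4.38).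
[cite: LemarieRieusset2016, §4.10 eqs. (4.37)–(4.38) (p. 63)] -/
theorem exists_abs_integral_fderiv_newtonKernel_mul_le_of_moments_eq_zero :
    ∃ K : ℝ, 0 < K ∧ ∀ {F : EuclideanSpace ℝ (Fin 3) → ℝ}, Integrable F volume →
      Integrable (fun y ↦ ‖y‖ ^ 2 * F y) volume → ∀ {C₅ : ℝ}, (∀ y, ‖y‖ ^ 5 * |F y| ≤ C₅) →
      (∫ y, F y) = 0 → (∫ y, F y • y) = 0 →
      ∀ {x : EuclideanSpace ℝ (Fin 3)}, 4 ≤ ‖x‖ → ∀ a : EuclideanSpace ℝ (Fin 3),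
        |∫ y, fderiv ℝ newtonKernel (x - y) a * F y| ≤
          K * ((∫ y, ‖y‖ ^ 2 * |F y|) + C₅) * ‖a‖ * ‖x‖⁻¹ ^ 4 := by
  obtain ⟨K, hK, h⟩ := exists_abs_integral_fderiv_newtonKernel_sub_dipole_le
  refine ⟨K, hK, fun {F} hFi hM2 {C₅} hC₅ h0 h1 {x} hx a ↦ ?_⟩
  have h' := h hFi hM2 hC₅ hx a
  simpa [h0, h1] using h'

/-- **Global weighted form, third order.** There is an absolute constant `K > 0` such that for every
bounded integrable `F : ℝ³ → ℝ` (`|F| ≤ C₀`) with `∫‖y‖|F| < ∞`, `‖y‖⁴|F(y)| ≤ C₄` and `∫ F = 0`,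
and all `x`, `a`:
`(1 + ‖x‖)³ |∫ ∂ₐΓ(x − y) F(y) dy| ≤ K (C₀ + ‖F‖₁ + ∫‖y‖|F| + C₄) ‖a‖`
(`‖x‖ ≥ 4`: `abs_integral_fderiv_newtonKernel_mul_le_of_integral_eq_zero` with `(1 + ‖x‖)³ ≤ 8‖x‖³`;
`‖x‖ ≤ 4`: the crude bound `‖a‖(3|B₁|C₀/(4π) + ‖F‖₁/(4π))` with `(1 + ‖x‖)³ ≤ 125`).
[cite: LemarieRieusset2016, §4.10 eq. (4.37) (p. 63)] -/
theorem exists_forall_one_add_norm_pow_three_mul_abs_integral_le :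
    ∃ K : ℝ, 0 < K ∧ ∀ {F : EuclideanSpace ℝ (Fin 3) → ℝ}, Integrable F volume →
      Integrable (fun y ↦ ‖y‖ * F y) volume → ∀ {C₀ : ℝ}, (∀ y, |F y| ≤ C₀) →
      ∀ {C₄ : ℝ}, (∀ y, ‖y‖ ^ 4 * |F y| ≤ C₄) → (∫ y, F y) = 0 →
      ∀ x a : EuclideanSpace ℝ (Fin 3),
        (1 + ‖x‖) ^ 3 * |∫ y, fderiv ℝ newtonKernel (x - y) a * F y| ≤
          K * (C₀ + (∫ y, |F y|) + (∫ y, ‖y‖ * |F y|) + C₄) * ‖a‖ := by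
  set V₁ : ℝ := (volume : Measure (EuclideanSpace ℝ (Fin 3))).real (ball 0 1) with hV₁
  have hV₁0 : 0 ≤ V₁ := measureReal_nonneg
  refine ⟨125 * (1 + V₁) + 24 + 8 * V₁, by positivity, fun {F} hFi hM1 {C₀} hC₀ {C₄} hC₄ h0 x a ↦ ?_⟩
  have hC00 : 0 ≤ C₀ := (abs_nonneg _).trans (hC₀ 0)
  have hC40 : 0 ≤ C₄ := le_trans (by positivity) (hC₄ 0)
  have hL1 : 0 ≤ ∫ y, |F y| := integral_nonneg fun y ↦ abs_nonneg _
  have hI1 : 0 ≤ ∫ y, ‖y‖ * |F y| := integral_nonneg fun y ↦ by positivity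
  have ha : 0 ≤ ‖a‖ := norm_nonneg a
  rcases lt_or_ge ‖x‖ 4 with hx | hx
  · -- near the origin: the crude bound
    have hcr := (integrable_fderiv_newtonKernel_sub_mul hFi (x := x) (fun y _ ↦ hC₀ y) a).2
    have hw : (1 + ‖x‖) ^ 3 ≤ 125 := by
      have h5 : 1 + ‖x‖ ≤ 5 := by linarith
      calc (1 + ‖x‖) ^ 3 ≤ (5 : ℝ) ^ 3 := pow_le_pow_left₀ (by positivity) h5 3
        _ = 125 := by norm_num
    have hcr' : |∫ y, fderiv ℝ newtonKernel (x - y) a * F y| ≤ ‖a‖ * (V₁ * C₀ + ∫ y, |F y|) := by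
      refine hcr.trans (mul_le_mul_of_nonneg_left ?_ ha)
      have h1 : 3 * V₁ * C₀ / (4 * π) ≤ V₁ * C₀ := by
        rw [div_le_iff₀ (by positivity)]; nlinarith [pi_gt_three, mul_nonneg hV₁0 hC00]
      have h2 : (4 * π)⁻¹ * (∫ y, |F y|) ≤ ∫ y, |F y| := by
        refine mul_le_of_le_one_left hL1 ?_
        rw [inv_le_one_iff₀]; right; nlinarith [pi_gt_three]
      exact add_le_add h1 h2
    calc (1 + ‖x‖) ^ 3 * |∫ y, fderiv ℝ newtonKernel (x - y) a * F y|
        ≤ 125 * (‖a‖ * (V₁ * C₀ + ∫ y, |F y|)) := mul_le_mul hw hcr' (abs_nonneg _) (by norm_num)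
      _ ≤ (125 * (1 + V₁) + 24 + 8 * V₁) * (C₀ + (∫ y, |F y|) + (∫ y, ‖y‖ * |F y|) + C₄) * ‖a‖ := by
          nlinarith [mul_nonneg hV₁0 hC00, mul_nonneg hV₁0 hL1, mul_nonneg hV₁0 hI1, mul_nonneg hV₁0 hC40,
            mul_nonneg ha (mul_nonneg hV₁0 hC00), mul_nonneg ha hL1, mul_nonneg ha hI1, mul_nonneg ha hC40,
            mul_nonneg ha (mul_nonneg hV₁0 hL1), mul_nonneg ha (mul_nonneg hV₁0 hI1),
            mul_nonneg ha (mul_nonneg hV₁0 hC40), mul_nonneg ha hC00]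
  · -- far from the origin: the first-order expansion
    have hx0 : 0 < ‖x‖ := lt_of_lt_of_le (by norm_num) hx
    have hfar := abs_integral_fderiv_newtonKernel_mul_le_of_integral_eq_zero hFi hM1 hC₄ h0 hx a
    have hw : (1 + ‖x‖) ^ 3 ≤ 8 * ‖x‖ ^ 3 := by
      have : 1 + ‖x‖ ≤ 2 * ‖x‖ := by linarith
      calc (1 + ‖x‖) ^ 3 ≤ (2 * ‖x‖) ^ 3 := pow_le_pow_left₀ (by positivity) this 3
        _ = 8 * ‖x‖ ^ 3 := by ring
    have hcoef : (17 / (2 * π)) * (∫ y, ‖y‖ * |F y|) + (3 * V₁ / π) * C₄ ≤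
        3 * (∫ y, ‖y‖ * |F y|) + V₁ * C₄ := by
      have h1 : 17 / (2 * π) ≤ 3 := by
        rw [div_le_iff₀ (by positivity)]; nlinarith [pi_gt_three]
      have h2 : 3 * V₁ / π ≤ V₁ := by
        rw [div_le_iff₀ pi_pos]; nlinarith [pi_gt_three]
      exact add_le_add (mul_le_mul_of_nonneg_right h1 hI1) (mul_le_mul_of_nonneg_right h2 hC40)
    have hfar' : |∫ y, fderiv ℝ newtonKernel (x - y) a * F y| ≤
        (3 * (∫ y, ‖y‖ * |F y|) + V₁ * C₄) * ‖a‖ * ‖x‖⁻¹ ^ 3 :=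
      hfar.trans (by gcongr)
    have hxx : ‖x‖ ^ 3 * ‖x‖⁻¹ ^ 3 = 1 := by
      rw [← mul_pow, mul_inv_cancel₀ hx0.ne', one_pow]
    calc (1 + ‖x‖) ^ 3 * |∫ y, fderiv ℝ newtonKernel (x - y) a * F y|
        ≤ 8 * ‖x‖ ^ 3 * ((3 * (∫ y, ‖y‖ * |F y|) + V₁ * C₄) * ‖a‖ * ‖x‖⁻¹ ^ 3) :=
          mul_le_mul hw hfar' (abs_nonneg _) (by positivity)
      _ = 8 * (3 * (∫ y, ‖y‖ * |F y|) + V₁ * C₄) * ‖a‖ * (‖x‖ ^ 3 * ‖x‖⁻¹ ^ 3) := by ring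
      _ = (24 * (∫ y, ‖y‖ * |F y|) + 8 * V₁ * C₄) * ‖a‖ := by rw [hxx]; ring
      _ ≤ (125 * (1 + V₁) + 24 + 8 * V₁) * (C₀ + (∫ y, |F y|) + (∫ y, ‖y‖ * |F y|) + C₄) * ‖a‖ := by
          apply mul_le_mul_of_nonneg_right _ ha
          nlinarith [mul_nonneg hV₁0 hC00, mul_nonneg hV₁0 hL1, mul_nonneg hV₁0 hI1, mul_nonneg hV₁0 hC40]

/-- **Global weighted form, fourth order.** There is an absolute constant `K > 0` such that for every
bounded integrable `F : ℝ³ → ℝ` (`|F| ≤ C₀`) with `∫‖y‖²|F| < ∞`, `‖y‖⁵|F(y)| ≤ C₅`, `∫ F = 0` and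
`∫ F(y) y dy = 0`, and all `x`, `a`:
`(1 + ‖x‖)⁴ |∫ ∂ₐΓ(x − y) F(y) dy| ≤ K (C₀ + ‖F‖₁ + ∫‖y‖²|F| + C₅) ‖a‖`
(`‖x‖ ≥ 4`: `exists_abs_integral_fderiv_newtonKernel_mul_le_of_moments_eq_zero` with
`(1 + ‖x‖)⁴ ≤ 16‖x‖⁴`; `‖x‖ ≤ 4`: the crude bound with `(1 + ‖x‖)⁴ ≤ 625`). This is the
`(1 + |x|)⁻⁴` tail of a gradient potential / Biot–Savart component / pressure gradient
`∇Δ⁻¹∇·f = ∫ ∇Γ(x − y)(∇·f)(y) dy` of a density with vanishing moments of order `≤ 1`.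
[cite: LemarieRieusset2016, §4.10 eqs. (4.37)–(4.38) (p. 63)] -/
theorem exists_forall_one_add_norm_pow_four_mul_abs_integral_le :
    ∃ K : ℝ, 0 < K ∧ ∀ {F : EuclideanSpace ℝ (Fin 3) → ℝ}, Integrable F volume →
      Integrable (fun y ↦ ‖y‖ ^ 2 * F y) volume → ∀ {C₀ : ℝ}, (∀ y, |F y| ≤ C₀) →
      ∀ {C₅ : ℝ}, (∀ y, ‖y‖ ^ 5 * |F y| ≤ C₅) → (∫ y, F y) = 0 → (∫ y, F y • y) = 0 →
      ∀ x a : EuclideanSpace ℝ (Fin 3),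
        (1 + ‖x‖) ^ 4 * |∫ y, fderiv ℝ newtonKernel (x - y) a * F y| ≤
          K * (C₀ + (∫ y, |F y|) + (∫ y, ‖y‖ ^ 2 * |F y|) + C₅) * ‖a‖ := by
  obtain ⟨K, hK, h⟩ := exists_abs_integral_fderiv_newtonKernel_mul_le_of_moments_eq_zero
  set V₁ : ℝ := (volume : Measure (EuclideanSpace ℝ (Fin 3))).real (ball 0 1) with hV₁
  have hV₁0 : 0 ≤ V₁ := measureReal_nonneg
  refine ⟨625 * (1 + V₁) + 16 * K, by positivity, fun {F} hFi hM2 {C₀} hC₀ {C₅} hC₅ h0 h1 x a ↦ ?_⟩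
  have hC00 : 0 ≤ C₀ := (abs_nonneg _).trans (hC₀ 0)
  have hC50 : 0 ≤ C₅ := le_trans (by positivity) (hC₅ 0)
  have hL1 : 0 ≤ ∫ y, |F y| := integral_nonneg fun y ↦ abs_nonneg _
  have hI2 : 0 ≤ ∫ y, ‖y‖ ^ 2 * |F y| := integral_nonneg fun y ↦ by positivity
  have ha : 0 ≤ ‖a‖ := norm_nonneg a
  rcases lt_or_ge ‖x‖ 4 with hx | hx
  · -- near the origin: the crude bound
    have hcr := (integrable_fderiv_newtonKernel_sub_mul hFi (x := x) (fun y _ ↦ hC₀ y) a).2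
    have hw : (1 + ‖x‖) ^ 4 ≤ 625 := by
      have h5 : 1 + ‖x‖ ≤ 5 := by linarith
      calc (1 + ‖x‖) ^ 4 ≤ (5 : ℝ) ^ 4 := pow_le_pow_left₀ (by positivity) h5 4
        _ = 625 := by norm_num
    have hcr' : |∫ y, fderiv ℝ newtonKernel (x - y) a * F y| ≤ ‖a‖ * (V₁ * C₀ + ∫ y, |F y|) := by
      refine hcr.trans (mul_le_mul_of_nonneg_left ?_ ha)
      have e1 : 3 * V₁ * C₀ / (4 * π) ≤ V₁ * C₀ := by
        rw [div_le_iff₀ (by positivity)]; nlinarith [pi_gt_three, mul_nonneg hV₁0 hC00]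
      have e2 : (4 * π)⁻¹ * (∫ y, |F y|) ≤ ∫ y, |F y| := by
        refine mul_le_of_le_one_left hL1 ?_
        rw [inv_le_one_iff₀]; right; nlinarith [pi_gt_three]
      exact add_le_add e1 e2
    calc (1 + ‖x‖) ^ 4 * |∫ y, fderiv ℝ newtonKernel (x - y) a * F y|
        ≤ 625 * (‖a‖ * (V₁ * C₀ + ∫ y, |F y|)) := mul_le_mul hw hcr' (abs_nonneg _) (by norm_num)
      _ ≤ (625 * (1 + V₁) + 16 * K) * (C₀ + (∫ y, |F y|) + (∫ y, ‖y‖ ^ 2 * |F y|) + C₅) * ‖a‖ := by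
          nlinarith [mul_nonneg hV₁0 hC00, mul_nonneg hV₁0 hL1, mul_nonneg hV₁0 hI2, mul_nonneg hV₁0 hC50,
            mul_nonneg ha (mul_nonneg hV₁0 hC00), mul_nonneg ha hL1, mul_nonneg ha hI2, mul_nonneg ha hC50,
            mul_nonneg ha (mul_nonneg hV₁0 hL1), mul_nonneg ha (mul_nonneg hV₁0 hI2),
            mul_nonneg ha (mul_nonneg hV₁0 hC50), mul_nonneg ha hC00, hK.le,
            mul_nonneg hK.le (mul_nonneg ha hC00), mul_nonneg hK.le (mul_nonneg ha hL1),
            mul_nonneg hK.le (mul_nonneg ha hI2), mul_nonneg hK.le (mul_nonneg ha hC50)]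
  · -- far from the origin: the second-order expansion with vanishing moments
    have hx0 : 0 < ‖x‖ := lt_of_lt_of_le (by norm_num) hx
    have hfar := h hFi hM2 hC₅ h0 h1 hx a
    have hw : (1 + ‖x‖) ^ 4 ≤ 16 * ‖x‖ ^ 4 := by
      have : 1 + ‖x‖ ≤ 2 * ‖x‖ := by linarith
      calc (1 + ‖x‖) ^ 4 ≤ (2 * ‖x‖) ^ 4 := pow_le_pow_left₀ (by positivity) this 4
        _ = 16 * ‖x‖ ^ 4 := by ring
    have hxx : ‖x‖ ^ 4 * ‖x‖⁻¹ ^ 4 = 1 := by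
      rw [← mul_pow, mul_inv_cancel₀ hx0.ne', one_pow]
    calc (1 + ‖x‖) ^ 4 * |∫ y, fderiv ℝ newtonKernel (x - y) a * F y|
        ≤ 16 * ‖x‖ ^ 4 * (K * ((∫ y, ‖y‖ ^ 2 * |F y|) + C₅) * ‖a‖ * ‖x‖⁻¹ ^ 4) :=
          mul_le_mul hw hfar (abs_nonneg _) (by positivity)
      _ = 16 * K * ((∫ y, ‖y‖ ^ 2 * |F y|) + C₅) * ‖a‖ * (‖x‖ ^ 4 * ‖x‖⁻¹ ^ 4) := by ring
      _ = 16 * K * ((∫ y, ‖y‖ ^ 2 * |F y|) + C₅) * ‖a‖ := by rw [hxx, mul_one]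
      _ ≤ (625 * (1 + V₁) + 16 * K) * (C₀ + (∫ y, |F y|) + (∫ y, ‖y‖ ^ 2 * |F y|) + C₅) * ‖a‖ := by
          apply mul_le_mul_of_nonneg_right _ ha
          nlinarith [mul_nonneg hV₁0 hC00, mul_nonneg hV₁0 hL1, mul_nonneg hV₁0 hI2, mul_nonneg hV₁0 hC50,
            hK.le, mul_nonneg hK.le hC00, mul_nonneg hK.le hL1]

end Corollaries

end Literature.Analysis.FluidPDE
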